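import Summits.Ventures.HSemireg.WedgeHankelSiegelIdealMonomials

/-!
# Venture HSemireg — THE SIEGEL IDEAL (3/3): `dim SI_k = C(2n,k) − (k+1)·C(n,k)`, `SI_k = ker(sym ∣ ⋀^k)`; with THEOREM H the EXCESS LAW
# `dim ker(θ ↦ θ ∧ w_n(q) ∣ ⋀^k) = dim SI_k + C(n,k)·(k+1 − rank H_k(q))`, the full-rank criterion, and `⋂_q ker = SI_k` for `2k ≤ n`

HONEST FRAMING. Part of the Lean index of the computation cell `pub-hsemireg` (seat p10 gen 11, Sunday typer «UNIFORM-IN-n»).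
Finite-dimensional EXTERIOR ALGEBRA over a field + ranks of Hankel matrices ONLY; no variety, no cohomology theory, no sheaf, no Ext group,
no semiregularity map; nothing here says that HC / HC_CM / HC_AV holds; no Literature fact is declared or used.  Custodian versions as in
`WedgeHankelSiegelIdeal` (1/3): FORMULA-N PART A §2.6 THEOREM H / FN-4 (i) «with v-independent kernel the Θ-isotropic part (on HT²: the
Siegel space S²_Θ)»; the dictionary (`Θ^p/p! ↦ δ_p ↦ E_p = w_n(δ_p)`; `⌟v` on `HT^k` ↦ `θ ↦ θ ∧ w_n(q)` on `⋀^k`) is QUOTED, never asserted.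

THIS FILE (continues namespace `Summit.Ventures.HSemireg.Wedge.HankelSiegelIdeal`; imports (2/3)):
* §5 **THE DIMENSION OF THE SIEGEL IDEAL: `dim SI_k + (k+1)·C(n,k) = C(2n,k)`** for every field, `n` and `k` (`finrank_siegelIdeal`;
  degree `2`: `n(n+1)/2`, degrees `k > n`: all of `⋀^k`) — lower bound from (2/3)'s reduction, upper bound from rank–nullity of `sym ∣ ⋀^k`
  and (2/3)'s independent images; hence **`ker_symk_eq_siegelIdeal`: `SI_k = ker(sym ∣ ⋀^k)`**, **`finrank_range_symk`: `rank(sym ∣ ⋀^k)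
  = (k+1)·C(n,k)`**, and the standard monomials are a BASIS OF A COMPLEMENT of `SI_k` in `⋀^k` (`linearIndependent_rep`, `finrank_repSpan`,
  `repSpan_sup_siegelIdeal`, `repSpan_inf_siegelIdeal`).
* §6 with THEOREM H: **THE EXCESS LAW `finrank_ker_wedge_w`: `dim ker(θ ↦ θ ∧ w_n(q) ∣ ⋀^k) = dim SI_k + C(n,k)·(k + 1 − rank H_k(q))`**
  for EVERY field, `n`, `k`, `q` — the `q`-dependent part of the kernel is `C(n,k)` copies of the row-corank of the Hankel matrix (degree `2`,
  `finrank_ker_wedge_w_two`: excess over the Siegel SPACE `= C(n,2)·(3 − rank H_2(q))`: `C(n,2)` for the Hankel-rank-`2` classes — point /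
  transverse / tangent pairs —, `2·C(n,2)` for the pure classes, `0` at the generic rank; cf. `WedgeHankelSpikes`, `WedgeHankelFaces` by value);
  **THE FULL-RANK CRITERION `ker_wedge_w_eq_siegelIdeal_iff` (`k ≤ n`): `ker(θ ↦ θ ∧ w_n(q) ∣ ⋀^k) = SI_k ⟺ rank H_k(q) = k + 1`**;
  `rank_hankel1_delta`: `H_k(δ_k)` has full row rank for `2k ≤ n`, so **`ker_wedge_delta_eq_siegelIdeal`: the class `E_k` (`Θ^k/k!`) has
  kernel EXACTLY `SI_k` on `⋀^k`, `2k ≤ n`**; hence **THE COMMON KERNEL `mem_siegelIdeal_iff_forall_mul_w` / `iInf_ker_wedge_w_eq_siegelIdeal`: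
  for `2k ≤ n`, `θ ∈ SI_k ⟺ θ ∧ w_n(q) = 0` for every `q`** — th-6's «v-independent kernel = the Θ-isotropic part» as a theorem in every degree
  up to the middle, with the isotropic part NAMED as the Siegel ideal.
NOT typed: the common kernel for `2k > n` (still `SI_k`, but no single class detects it — every `H_k(q)` has row-corank `≥ 2k − n` there; needs
several classes or a stabilisation in `n`); boxes of several factors (the product Siegel ideals; cf. `WedgeHankelBoxSiegel`); which non-monomial
classes have full-rank `H_k(q)` (Zariski-open); anything Ext-side.  Class side only.
-/

open Module

namespace Summit.Ventures.HSemireg.Wedge.HankelSiegelIdeal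

open Summit.Ventures.HSemireg.Wedge Summit.Ventures.HSemireg.Wedge.Hankel
  Summit.Ventures.HSemireg.Wedge.HankelSiegel

variable (K : Type*) [Field K] {n : ℕ}

/-! ## §5. Dimensions: `dim SI_k = C(2n,k) − (k+1)·C(n,k)`, `SI_k = ker(sym ∣ ⋀^k)`, the standard monomials are a basis of a complement -/

/-- the standard monomials span a subspace of `⋀^k`. -/
theorem repSpan_le_exteriorPower (k : ℕ) : repSpan K n k ≤ ⋀[K]^k (In n → K) := by
  rw [repSpan, Submodule.span_le]
  rintro _ ⟨p, rfl⟩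
  exact rep_mem_exteriorPower K p

/-- **`span{r_{S,i}} ⊔ SI_k = ⋀^k`.** -/
theorem repSpan_sup_siegelIdeal (k : ℕ) : repSpan K n k ⊔ siegelIdeal K n k = ⋀[K]^k (In n → K) :=
  le_antisymm (sup_le (repSpan_le_exteriorPower K k) (siegelIdeal_le_exteriorPower K k)) (exteriorPower_le_repSpan_sup K k)

/-- `dim ⋀^k K^{2n} = C(2n, k)`. -/
lemma finrank_exteriorPower (k : ℕ) : finrank K (⋀[K]^k (In n → K)) = (n + n).choose k := by
  rw [exteriorPower.finrank_eq, finrank_fintype_fun_eq_card, Fintype.card_fin]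

/-- `dim span{r_{S,i}} ≤ (k+1)·C(n,k)`. -/
lemma finrank_repSpan_le (k : ℕ) : finrank K (repSpan K n k) ≤ (k + 1) * n.choose k := by
  rw [← card_RIdx (n := n) k]
  exact finrank_range_le_card _

/-- lower bound: `C(2n,k) ≤ (k+1)·C(n,k) + dim SI_k`. -/
lemma finrank_siegelIdeal_ge (k : ℕ) : (n + n).choose k ≤ (k + 1) * n.choose k + finrank K (siegelIdeal K n k) := by
  have h := Submodule.finrank_add_le_finrank_add_finrank (repSpan K n k) (siegelIdeal K n k)
  rw [repSpan_sup_siegelIdeal, finrank_exteriorPower] at h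
  have := finrank_repSpan_le K (n := n) k
  omega

/-- `SI_k` (inside `⋀^k`) lies in the kernel of the symmetrisation. -/
lemma comap_siegelIdeal_le_ker_symk (k : ℕ) :
    (siegelIdeal K n k).comap (⋀[K]^k (In n → K)).subtype ≤ LinearMap.ker (symk K n k) := by
  intro θ hθ
  rw [LinearMap.mem_ker, symk, LinearMap.comp_apply, Submodule.subtype_apply, AlgHom.toLinearMap_apply]
  exact sym_eq_zero_of_mem_siegelIdeal K hθ

/-- the comap along `⋀^k ↪ ⋀` does not change the dimension of `SI_k ⊆ ⋀^k`. -/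
lemma finrank_comap_siegelIdeal (k : ℕ) :
    finrank K ((siegelIdeal K n k).comap (⋀[K]^k (In n → K)).subtype) = finrank K (siegelIdeal K n k) :=
  (Submodule.comapSubtypeEquivOfLe (siegelIdeal_le_exteriorPower K k)).finrank_eq

/-- upper bound: `dim SI_k + (k+1)·C(n,k) ≤ C(2n,k)` (rank–nullity for `sym ∣ ⋀^k`). -/
lemma finrank_siegelIdeal_le (k : ℕ) : finrank K (siegelIdeal K n k) + (k + 1) * n.choose k ≤ (n + n).choose k := by
  have h1 := LinearMap.finrank_range_add_finrank_ker (symk K n k)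
  rw [finrank_exteriorPower] at h1
  have h2 := card_le_finrank_range_symk K (n := n) k
  have h3 := Submodule.finrank_mono (comap_siegelIdeal_le_ker_symk K (n := n) k)
  rw [finrank_comap_siegelIdeal] at h3
  omega

/-- **THE DIMENSION OF THE SIEGEL IDEAL: `dim SI_k + (k+1)·C(n,k) = C(2n,k)`** — for every field, every `n`, every degree `k`
(`dim SI_k = C(2n,k) − (k+1)·C(n,k)`; degree `2`: `n(n+1)/2`; degree `k > n`: all of `⋀^k`). -/
theorem finrank_siegelIdeal (k : ℕ) : finrank K (siegelIdeal K n k) + (k + 1) * n.choose k = (n + n).choose k :=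
  le_antisymm (finrank_siegelIdeal_le K k) (by have := finrank_siegelIdeal_ge K (n := n) k; omega)

/-- **THE RANK OF THE SYMMETRISATION ON `⋀^k` IS `(k+1)·C(n,k)`** (`= dim ⋀^k K^n ⊗ S^k K²`). -/
theorem finrank_range_symk (k : ℕ) : finrank K (LinearMap.range (symk K n k)) = (k + 1) * n.choose k := by
  have h1 := LinearMap.finrank_range_add_finrank_ker (symk K n k)
  rw [finrank_exteriorPower] at h1
  have h2 := card_le_finrank_range_symk K (n := n) k
  have h3 := Submodule.finrank_mono (comap_siegelIdeal_le_ker_symk K (n := n) k)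
  rw [finrank_comap_siegelIdeal] at h3
  have h4 := finrank_siegelIdeal_ge K (n := n) k
  omega

/-- **THE SIEGEL IDEAL IS THE KERNEL OF THE SYMMETRISATION: `ker(sym ∣ ⋀^k) = SI_k`.** -/
theorem ker_symk_eq_siegelIdeal (k : ℕ) :
    LinearMap.ker (symk K n k) = (siegelIdeal K n k).comap (⋀[K]^k (In n → K)).subtype := by
  symm
  apply Submodule.eq_of_le_of_finrank_eq (comap_siegelIdeal_le_ker_symk K k)
  have h1 := LinearMap.finrank_range_add_finrank_ker (symk K n k)
  rw [finrank_exteriorPower, finrank_range_symk] at h1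
  have h2 := finrank_siegelIdeal K (n := n) k
  rw [finrank_comap_siegelIdeal]
  omega

/-- **`dim span{r_{S,i}} = (k+1)·C(n,k)`.** -/
theorem finrank_repSpan (k : ℕ) : finrank K (repSpan K n k) = (k + 1) * n.choose k := by
  apply le_antisymm (finrank_repSpan_le K k)
  have h := Submodule.finrank_add_le_finrank_add_finrank (repSpan K n k) (siegelIdeal K n k)
  rw [repSpan_sup_siegelIdeal, finrank_exteriorPower] at h
  have h2 := finrank_siegelIdeal K (n := n) k
  omega

/-- **THE STANDARD MONOMIALS ARE LINEARLY INDEPENDENT** (hence a basis of `span{r_{S,i}}`). -/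
theorem linearIndependent_rep (k : ℕ) : LinearIndependent K (rep K (n := n) (k := k)) := by
  rw [linearIndependent_iff_card_eq_finrank_span, Set.finrank, card_RIdx]
  exact (finrank_repSpan K k).symm

/-- **… AND SPAN A COMPLEMENT OF THE SIEGEL IDEAL: `span{r_{S,i}} ⊓ SI_k = 0`** (with `⊔ = ⋀^k` above). -/
theorem repSpan_inf_siegelIdeal (k : ℕ) : repSpan K n k ⊓ siegelIdeal K n k = ⊥ := by
  rw [← Submodule.finrank_eq_zero]
  have h := Submodule.finrank_sup_add_finrank_inf_eq (repSpan K n k) (siegelIdeal K n k)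
  rw [repSpan_sup_siegelIdeal, finrank_exteriorPower, finrank_repSpan] at h
  have h2 := finrank_siegelIdeal K (n := n) k
  omega

/-! ## §6. With THEOREM H: the excess law, the full-rank criterion, the power `Θ^k`, the common kernel (`2k ≤ n`) -/

/-- a Hankel matrix `H_k(q)` has at most `k + 1` (= number of rows) independent rows. -/
lemma rank_hankel1_le_succ (k : ℕ) (q : ℕ → K) : (hankel1 K n k q).rank ≤ k + 1 :=
  Matrix.rank_le_height _

/-- **THE EXCESS LAW: `dim ker(θ ↦ θ ∧ w_n(q) ∣ ⋀^k) = dim SI_k + C(n,k)·(k + 1 − rank H_k(q))`** for every field, `n`, `k`, `q`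
(THEOREM H + the dimension of the Siegel ideal: the `q`-dependent part of the kernel is `C(n,k)` copies of the row-corank of the Hankel matrix). -/
theorem finrank_ker_wedge_w (k : ℕ) (q : ℕ → K) :
    finrank K (LinearMap.ker (Hankel.wedge K n k (w K n n q))) =
      finrank K (siegelIdeal K n k) + n.choose k * (k + 1 - (hankel1 K n k q).rank) := by
  have h1 := LinearMap.finrank_range_add_finrank_ker (Hankel.wedge K n k (w K n n q))
  rw [finrank_exteriorPower, hankelLaw_model] at h1
  have h2 := finrank_siegelIdeal K (n := n) k
  obtain ⟨d, hd⟩ := Nat.exists_eq_add_of_le (rank_hankel1_le_succ K (n := n) k q)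
  have h4 : k + 1 - (hankel1 K n k q).rank = d := by omega
  rw [h4]
  have h3 : (k + 1) * n.choose k = n.choose k * (hankel1 K n k q).rank + n.choose k * d := by
    generalize (hankel1 K n k q).rank = r at hd ⊢
    rw [hd]; ring
  rw [h3] at h2
  generalize n.choose k * (hankel1 K n k q).rank = X at h1 h2
  generalize n.choose k * d = Y at h2 ⊢
  omega

/-- in degree `2`: **`dim ker(θ ↦ θ ∧ w_n(q) ∣ ⋀²) = dim Siegel_n + C(n,2)·(3 − rank H_2(q))`** — the excess over th-6's Siegel space is `C(n,2)` for the
Hankel-rank-`2` classes (point / transverse / tangent pairs), `2·C(n,2)` for the pure classes, `0` at the generic rank `3`. -/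
theorem finrank_ker_wedge_w_two (q : ℕ → K) :
    finrank K (LinearMap.ker (Hankel.wedge K n 2 (w K n n q))) =
      finrank K (siegel K n) + n.choose 2 * (3 - (hankel1 K n 2 q).rank) := by
  rw [finrank_ker_wedge_w, siegelIdeal_two]

/-- **FULL ROW RANK ⇒ THE KERNEL IS EXACTLY THE SIEGEL IDEAL: `rank H_k(q) = k + 1 ⇒ ker(θ ↦ θ ∧ w_n(q) ∣ ⋀^k) = SI_k`.** -/
theorem ker_wedge_w_eq_siegelIdeal_of_rank {k : ℕ} {q : ℕ → K} (h : (hankel1 K n k q).rank = k + 1) :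
    LinearMap.ker (Hankel.wedge K n k (w K n n q)) = (siegelIdeal K n k).comap (⋀[K]^k (In n → K)).subtype := by
  symm
  apply Submodule.eq_of_le_of_finrank_eq (siegelIdeal_le_ker K k q)
  rw [finrank_comap_siegelIdeal, finrank_ker_wedge_w, h, Nat.sub_self, mul_zero, add_zero]

/-- conversely (for `k ≤ n`): if the kernel is the Siegel ideal then `H_k(q)` has full row rank. -/
theorem rank_eq_of_ker_wedge_w_eq_siegelIdeal {k : ℕ} (hk : k ≤ n) {q : ℕ → K}
    (h : LinearMap.ker (Hankel.wedge K n k (w K n n q)) = (siegelIdeal K n k).comap (⋀[K]^k (In n → K)).subtype) :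
    (hankel1 K n k q).rank = k + 1 := by
  have h1 := finrank_ker_wedge_w K (n := n) k q
  rw [h, finrank_comap_siegelIdeal] at h1
  have h0 : n.choose k * (k + 1 - (hankel1 K n k q).rank) = 0 := by omega
  rcases Nat.mul_eq_zero.mp h0 with h0 | h0
  · exact absurd h0 (Nat.choose_pos hk).ne'
  · have := rank_hankel1_le_succ K (n := n) k q; omega

/-- **THE FULL-RANK CRITERION (`k ≤ n`): `ker(θ ↦ θ ∧ w_n(q) ∣ ⋀^k) = SI_k ⟺ rank H_k(q) = k + 1`.** -/
theorem ker_wedge_w_eq_siegelIdeal_iff {k : ℕ} (hk : k ≤ n) (q : ℕ → K) :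
    LinearMap.ker (Hankel.wedge K n k (w K n n q)) = (siegelIdeal K n k).comap (⋀[K]^k (In n → K)).subtype ↔
      (hankel1 K n k q).rank = k + 1 :=
  ⟨rank_eq_of_ker_wedge_w_eq_siegelIdeal K hk, ker_wedge_w_eq_siegelIdeal_of_rank K⟩

/-- the Hankel matrix of the spike `δ_k` (`w_n(δ_k) = E_k`, the class `Θ^k/k!`) has full row rank `k + 1` when `2k ≤ n`
(row `i` is the unit vector at column `k − i`). -/
theorem rank_hankel1_delta {k : ℕ} (hk : k + k ≤ n) :
    (hankel1 K n k (fun j => if j = k then (1 : K) else 0)).rank = k + 1 := by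
  let e : Fin (k + 1) → Fin (n + 1 - k) := fun i => ⟨k - i, by omega⟩
  have he : Function.Injective e := by
    intro i j h
    have h' := congrArg Fin.val h
    simp only [e] at h'
    exact Fin.ext (by omega)
  have hrow : (hankel1 K n k (fun j => if j = k then (1 : K) else 0)).row = ⇑(Pi.basisFun K (Fin (n + 1 - k))) ∘ e := by
    funext i s
    simp only [Function.comp_apply, Matrix.row, hankel1, Matrix.of_apply, Pi.basisFun_apply, Pi.single_apply, e,
      Fin.ext_iff]
    by_cases h : (i : ℕ) + s = k
    · rw [if_pos h, if_pos (by omega)]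
    · rw [if_neg h, if_neg (by omega)]
  rw [Matrix.rank_eq_finrank_span_row, hrow, finrank_span_eq_card ((Pi.basisFun K (Fin (n + 1 - k))).linearIndependent.comp e he),
    Fintype.card_fin]

/-- **THE `k`-TH POWER OF THE POLARISATION SEES EXACTLY THE SIEGEL IDEAL (`2k ≤ n`): `ker(θ ↦ θ ∧ E_k ∣ ⋀^k) = SI_k`**, `E_k = w_n(δ_k)`. -/
theorem ker_wedge_delta_eq_siegelIdeal {k : ℕ} (hk : k + k ≤ n) :
    LinearMap.ker (Hankel.wedge K n k (w K n n (fun j => if j = k then (1 : K) else 0))) =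
      (siegelIdeal K n k).comap (⋀[K]^k (In n → K)).subtype :=
  ker_wedge_w_eq_siegelIdeal_of_rank K (rank_hankel1_delta K hk)

/-- **THE COMMON KERNEL (`2k ≤ n`)**: a `k`-form killed by the single class `E_k` already lies in the Siegel ideal. -/
theorem mem_siegelIdeal_of_mul_delta {k : ℕ} (hk : k + k ≤ n) {θ : HT K (In n)} (hθ : θ ∈ ⋀[K]^k (In n → K))
    (h : θ * w K n n (fun j => if j = k then (1 : K) else 0) = 0) : θ ∈ siegelIdeal K n k := by
  have hker : (⟨θ, hθ⟩ : ⋀[K]^k (In n → K)) ∈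
      LinearMap.ker (Hankel.wedge K n k (w K n n (fun j => if j = k then (1 : K) else 0))) := by
    rw [LinearMap.mem_ker, Hankel.wedge, LinearMap.comp_apply, Submodule.subtype_apply, LinearMap.mulRight_apply]
    exact h
  rw [ker_wedge_delta_eq_siegelIdeal K hk] at hker
  exact hker

/-- **`SI_k` IS THE `q`-INDEPENDENT KERNEL (`2k ≤ n`): `θ ∈ SI_k ⟺ θ ∧ w_n(q) = 0` for every `q`** (th-6's «v-independent kernel = the
Θ-isotropic part», in every degree up to the middle). -/
theorem mem_siegelIdeal_iff_forall_mul_w {k : ℕ} (hk : k + k ≤ n) {θ : HT K (In n)} (hθ : θ ∈ ⋀[K]^k (In n → K)) :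
    θ ∈ siegelIdeal K n k ↔ ∀ q : ℕ → K, θ * w K n n q = 0 :=
  ⟨fun h q => mul_w_eq_zero_of_mem_siegelIdeal K h q, fun h => mem_siegelIdeal_of_mul_delta K hk hθ (h _)⟩

/-- the same as an intersection of kernels: **`⋂_q ker(θ ↦ θ ∧ w_n(q) ∣ ⋀^k) = SI_k`** (`2k ≤ n`). -/
theorem iInf_ker_wedge_w_eq_siegelIdeal {k : ℕ} (hk : k + k ≤ n) :
    (⨅ q : ℕ → K, LinearMap.ker (Hankel.wedge K n k (w K n n q))) = (siegelIdeal K n k).comap (⋀[K]^k (In n → K)).subtype := by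
  apply le_antisymm
  · intro θ hθ
    rw [← ker_wedge_delta_eq_siegelIdeal K hk]
    exact (Submodule.mem_iInf _).mp hθ _
  · exact le_iInf fun q => siegelIdeal_le_ker K k q

end Summit.Ventures.HSemireg.Wedge.HankelSiegelIdeal
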